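import Summits.KontsevichZagierPeriods.KontsevichZagierPeriods.Theses.HyperbolicBloch

/-!
# `PachnerTwoThree`: the two unions of the 2–3 move are NOT equal as sets

Negative knowledge for the crux `HyperbolicBloch.PachnerTwoThree`
(stmt-KontsevichZagierPeriods-3470; refuter, cdisprove g2).  The natural strengthening
"prism(u,v,w) ∪ inner = prism(u,v,q) ∪ prism(v,w,q) ∪ prism(w,u,q) AS SETS" — which would make
the crux two bare `domainAddRel` moves — is FALSE: at `u, v, w, q = −5, 5, 5i, 2i` the rational
point `p = (12/5, 9/5, 4)` lies on the big hemisphere `|p| = 5` over the open triangle, off the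
three spokes; it belongs to `prism(v,w,q)` and to neither `prism(u,v,w)` (`S = 0`, not `> 0`) nor
the inner tetrahedron (`S = 0`, not `< 0`).  The crux itself is TRUE (a.e. equality of the unions
+ null-set bookkeeping): see the crux work file `Cruxes/PachnerTwoThree/Disproof.lean`.
-/

noncomputable section

open Set MeasureTheory

namespace Summit.KontsevichZagierPeriods.HyperbolicBloch.ExactUnion

/-- Gaussian integers are algebraic over `ℚ` (`a + bi` with `i² + 1 = 0`). -/
theorem isAlgebraic_mk_int (a b : ℤ) : IsAlgebraic ℚ (⟨a, b⟩ : ℂ) := by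
  have hI : IsAlgebraic ℚ Complex.I :=
    ⟨Polynomial.X ^ 2 + 1, Polynomial.Monic.ne_zero (by monicity!), by simp⟩
  have h : (⟨a, b⟩ : ℂ) = ((a : ℚ) : ℂ) + ((b : ℚ) : ℂ) * Complex.I := by
    apply Complex.ext <;> simp
  rw [h]
  exact (isAlgebraic_algebraMap (R := ℚ) (A := ℂ) (a : ℚ)).add
    ((isAlgebraic_algebraMap (R := ℚ) (A := ℂ) (b : ℚ)).mul hI)

/-- **Refuted strengthening of the crux `PachnerTwoThree`: the unions are NOT equal as sets**
(crux hypotheses verbatim, conclusion replaced by literal set equality).  Witness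
`u, v, w, q = −5, 5, 5i, 2i`, `p = (12/5, 9/5, 4)` on the big hemisphere. -/
theorem not_exactUnion : ¬ (
  ∀ (L : ℂ → ℂ → (Fin 3 → ℝ) → ℝ), (∀ u v p, L u v p = (v.re - u.re) * (p 1 - u.im) - (v.im - u.im) * (p 0 - u.re)) →
    ∀ (S : ℂ → ℂ → ℂ → (Fin 3 → ℝ) → ℝ), (∀ u v w p, S u v w p = (p 0 ^ 2 + p 1 ^ 2 + p 2 ^ 2) * (u.re * (v.im - w.im) - u.im * (v.re - w.re) + (v.re * w.im - v.im * w.re)) - p 0 * (Complex.normSq u * (v.im - w.im) - u.im * (Complex.normSq v - Complex.normSq w) + (Complex.normSq v * w.im - v.im * Complex.normSq w)) + p 1 * (Complex.normSq u * (v.re - w.re) - u.re * (Complex.normSq v - Complex.normSq w) + (Complex.normSq v * w.re - v.re * Complex.normSq w)) - (Complex.normSq u * (v.re * w.im - v.im * w.re) - u.re * (Complex.normSq v * w.im - v.im * Complex.normSq w) + u.im * (Complex.normSq v * w.re - v.re * Complex.normSq w))) →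
    ∀ (P : ℂ → ℂ → ℂ → Set (Fin 3 → ℝ)),
      (∀ u v w, P u v w = {p | 0 < p 2 ∧ 0 < L u v p ∧ 0 < L v w p ∧ 0 < L w u p ∧ 0 < S u v w p}) →
    ∀ (u v w q : ℂ), IsAlgebraic ℚ u → IsAlgebraic ℚ v → IsAlgebraic ℚ w → IsAlgebraic ℚ q →
      0 < L u v ![q.re, q.im, 0] → 0 < L v w ![q.re, q.im, 0] → 0 < L w u ![q.re, q.im, 0] →
      P u v w ∪ {p | 0 < p 2 ∧ S u v w p < 0 ∧ 0 < S u v q p ∧ 0 < S v w q p ∧ 0 < S w u q p}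
        = P u v q ∪ P v w q ∪ P w u q) := by
  intro h
  have key := h (fun u v p => (v.re - u.re) * (p 1 - u.im) - (v.im - u.im) * (p 0 - u.re)) (fun _ _ _ => rfl) (fun u v w p => (p 0 ^ 2 + p 1 ^ 2 + p 2 ^ 2) * (u.re * (v.im - w.im) - u.im * (v.re - w.re) + (v.re * w.im - v.im * w.re)) - p 0 * (Complex.normSq u * (v.im - w.im) - u.im * (Complex.normSq v - Complex.normSq w) + (Complex.normSq v * w.im - v.im * Complex.normSq w)) + p 1 * (Complex.normSq u * (v.re - w.re) - u.re * (Complex.normSq v - Complex.normSq w) + (Complex.normSq v * w.re - v.re * Complex.normSq w)) - (Complex.normSq u * (v.re * w.im - v.im * w.re) - u.re * (Complex.normSq v * w.im - v.im * Complex.normSq w) + u.im * (Complex.normSq v * w.re - v.re * Complex.normSq w))) (fun _ _ _ _ => rfl)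
    (fun u v w => {p | 0 < p 2 ∧ 0 < ((v.re - u.re) * (p 1 - u.im) - (v.im - u.im) * (p 0 - u.re)) ∧ 0 < ((w.re - v.re) * (p 1 - v.im) - (w.im - v.im) * (p 0 - v.re)) ∧ 0 < ((u.re - w.re) * (p 1 - w.im) - (u.im - w.im) * (p 0 - w.re)) ∧ 0 < (p 0 ^ 2 + p 1 ^ 2 + p 2 ^ 2) * (u.re * (v.im - w.im) - u.im * (v.re - w.re) + (v.re * w.im - v.im * w.re)) - p 0 * (Complex.normSq u * (v.im - w.im) - u.im * (Complex.normSq v - Complex.normSq w) + (Complex.normSq v * w.im - v.im * Complex.normSq w)) + p 1 * (Complex.normSq u * (v.re - w.re) - u.re * (Complex.normSq v - Complex.normSq w) + (Complex.normSq v * w.re - v.re * Complex.normSq w)) - (Complex.normSq u * (v.re * w.im - v.im * w.re) - u.re * (Complex.normSq v * w.im - v.im * Complex.normSq w) + u.im * (Complex.normSq v * w.re - v.re * Complex.normSq w))})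
    (fun _ _ _ => rfl) ⟨-5, 0⟩ ⟨5, 0⟩ ⟨0, 5⟩ ⟨0, 2⟩
    (by simpa using isAlgebraic_mk_int (-5) 0) (by simpa using isAlgebraic_mk_int 5 0)
    (by simpa using isAlgebraic_mk_int 0 5) (by simpa using isAlgebraic_mk_int 0 2)
    (by norm_num) (by norm_num) (by norm_num)
  set p : Fin 3 → ℝ := ![12 / 5, 9 / 5, 4] with hp
  have h0 : p 0 = 12 / 5 := rfl
  have h1 : p 1 = 9 / 5 := rfl
  have h2 : p 2 = 4 := rfl
  have hmem := Set.ext_iff.mp key p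
  simp only [mem_union, mem_setOf_eq, h0, h1, h2] at hmem
  norm_num at hmem

end Summit.KontsevichZagierPeriods.HyperbolicBloch.ExactUnion
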